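import Literature.Analysis.FluidPDE.FluidComputer.ThresholdLevelTableL
import HarnessLib

/-!
# Kernel run of the re-cut level-table checker, chunks 28 … 31 (steps 700 … 799) (bp3 gen 13)

HONEST FRAMING: low prior, high value-of-information experiment on Tao's machine paradigm; NOT a
claim that NS blows up.

Four kernel evaluations (`decide +kernel`; no `native_decide`, no extra axioms) of the checker
`runSteps` (`ThresholdLevelCheck.lean`) on 25 steps of `ThresholdLevelTableL.stepsT` at a time, from
the entry box `Bc i` towards the next chunk's first level, returning the entry box `Bc (i+1)`
(≈ 30 s of kernel time per chunk; same scheme as `ThresholdLevelTableRun0 … 7`).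
-/

namespace Literature.Analysis.FluidPDE.FluidComputer

namespace ThresholdLevelTableL

open ThresholdLevelTable (GIt RbIt)

set_option maxHeartbeats 10000000 in
set_option maxRecDepth 200000 in
/-- Chunk 28 of the re-cut table run (steps 700 … 724). [folklore] -/
theorem run28 : runSteps 60 12 3 GIt RbIt Bc28 chunk28 4319306013593774 = some Bc29 := by
  decide +kernel

set_option maxHeartbeats 10000000 in
set_option maxRecDepth 200000 in
/-- Chunk 29 of the re-cut table run (steps 725 … 749). [folklore] -/
theorem run29 : runSteps 60 12 3 GIt RbIt Bc29 chunk29 4890675910464709 = some Bc30 := by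
  decide +kernel

set_option maxHeartbeats 10000000 in
set_option maxRecDepth 200000 in
/-- Chunk 30 of the re-cut table run (steps 750 … 774). [folklore] -/
theorem run30 : runSteps 60 12 3 GIt RbIt Bc30 chunk30 5537628217570725 = some Bc31 := by
  decide +kernel

set_option maxHeartbeats 10000000 in
set_option maxRecDepth 200000 in
/-- Chunk 31 of the re-cut table run (steps 775 … 799). [folklore] -/
theorem run31 : runSteps 60 12 3 GIt RbIt Bc31 chunk31 6270161187826846 = some Bc32 := by
  decide +kernel

end ThresholdLevelTableL

end Literature.Analysis.FluidPDE.FluidComputer
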